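import Summits.HodgeConjecture.HodgeConjecture.Theorems.SixfoldTableXCensusWeilRow19AllMembers
import Literature.AlgebraicGeometry.HodgeTheory.WeilTypeCentralWeilClassesExceptional
import Literature.AlgebraicGeometry.HodgeTheory.WeilTypeHodgeLieNoThinCorner
import HarnessLib

/-!
# TABLE X (dimension 6) — the simple-`End⁰`-commutative Weil rows 9 ∕ 11 ∕ 13 and the product row 19: `B(A) ≠ D(A)` AT EVERY
# MEMBER — the Weil classes are NOT in the divisor span, so the displayed residue binder `WeilSixfolds` ∕ Markman₆ is LOAD-BEARING
# (cell `pub-hodgeav-hg6`, req-37 (A) Q2b; eng-4 g9, T2 row instances; lead g4 GO 2026-08-29T08:05:17Z)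

HONEST FRAMING. HC, `HC_AV` (stmt-1333), `HC_CM` (stmt-3052) and H2 are NOT proved and do not occur. Nothing here says the Weil
classes are algebraic or not algebraic: the statement is `¬ IsDivisorGenerated A` — some rational Hodge class of `A` (a Weil class
of degree `6`) lies outside the complexified divisor ring, so at these rows the Hodge conjecture is NOT a consequence of Lefschetz
`(1,1)` and the census's Weil summand (`weilClassesOf`, X1) is not empty decoration. KERNEL ONLY: one-line theorems over the tree's
`IsWeilType.not_isDivisorGenerated_of_forall_mem_adjoin` ∕ `…_of_mem_centralizerAlgebra` (`HodgeTheory/WeilTypeCentralWeilClassesExceptional`,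
Moonen–Zarhin 1998 Criterion (2) at `u = φ`); no definition, no `sorry`, no named fact; restates nothing.

BINDERS = the rows' own (`hW : IsWeilType A φ 3 d`, a rational class `h` with a Kähler multiple — `hQ`, `hK` — for which `φ^*`
is a `d`-similitude of `Q_h` — `hφQ`, as in every census file of rows 9 ∕ 11 ∕ 13 ∕ 19) plus the row's form of «`φ^*` is central
on `H¹`»: row 9 `finrank_ℚ End⁰(A) = 2` (`pullbackOne_mem_adjoin_of_finrank_endAlgebra_eq_two`), rows 11 ∕ 13 Milne's single-generator
datum `hgen : ∀ ψ, ψ^* ∈ ℂ[φ_E^*]`, row 19 Milne's `hC : C(A) ⊗ ℂ = Z(φ_E^*)` together with `φ ≫ φ_E = φ_E ≫ φ`. (The producer needs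
`h` to be ONE rational `(1,1)` hard-Lefschetz class — the (hQ, hK) shape of rows 11 ∕ 13 ∕ 19 — rather than row 9's weaker
(`hh ∈ hodgeClassSpan`, `hnd`) pair of `census_weilType_endK'`; every member carries such an `h`.)
* `not_isDivisorGenerated_weilRow_of_forall_mem_adjoin` — rows 11 ∕ 13 (and any row with `hgen`);
* `not_isDivisorGenerated_row9_endK` — row 9 (`End⁰ = K`);
* `not_isDivisorGenerated_row19_of_centralizer` — row 19 in L17's `hC` vocabulary.
All declarations in `TableX.WeilLieRows`; typed ≠ proved.
-/

set_option linter.dupNamespace false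

noncomputable section

open scoped TensorProduct
open CategoryTheory Polynomial
open Literature.AlgebraicGeometry Literature.AlgebraicGeometry.Motives
open Literature.AlgebraicGeometry.Motives.HodgeStructure
open Literature.AlgebraicGeometry.HodgeTheory
open Literature.AlgebraicGeometry.Milne1999
open Literature.AlgebraicGeometry.Deligne1982 (isOfHodgeType_one_one_of_isKaehlerClass_smul)
open Literature.AlgebraicGeometry.VanGeemen1994 (pullbackOne)
open Literature.AlgebraicTopology.SingularHomology
open Literature.Geometry.Kaehler (HasHardLefschetzProperty)

namespace Summit.HodgeConjecture.HodgeConjecture.TableX.WeilLieRows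

variable {A : AbelianVariety ℂ} {φ : A ⟶ A} {d : ℕ} {h : complexBetti A.X 2}

/-- A rational class with a Kähler multiple is a rational `(1,1)` hard-Lefschetz class (as in R11-7 ∕ the row-19 census).
[cite: VoisinHodgeI2002, Thm. 6.25] [cite: Deligne1982HodgeCycles, I §3 Prop. 3.6] -/
private theorem polClass_of_kaehler (hK : ∃ s : ℝ, 0 < s ∧ IsKaehlerClass A.dim A.X ((s : ℂ) • h)) :
    IsOfHodgeType A.dim A.X 2 1 1 h ∧ HasHardLefschetzProperty h A.dim := by
  have hX : IsSmoothProjective A.dim A.X := AbelianVariety.isSmoothProjective_holds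
  obtain ⟨s, hs, hsK⟩ := hK
  refine ⟨isOfHodgeType_one_one_of_isKaehlerClass_smul ⟨s, hs.ne', hsK⟩, ?_⟩
  have h1 := HasHardLefschetzProperty.smul
    (hsK.hasHardLefschetzProperty hX fun _ ↦ Motives.hasHardLefschetzProperty_kaehlerClass_holds)
    (inv_ne_zero (Complex.ofReal_ne_zero.2 hs.ne'))
  rwa [smul_smul, inv_mul_cancel₀ (Complex.ofReal_ne_zero.2 hs.ne'), one_smul] at h1

/-- **ROWS 11 ∕ 13 (and every Weil row with Milne's single-generator datum), EVERY MEMBER: `B(A) ≠ D(A)`** — for `(A, φ)` of Weil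
type `(3, d)` with every pull-back a polynomial in `φ_E^*` (`hgen`: `End⁰(A) ⊗ ℂ` commutative on `H¹`, e.g. `End⁰ = E` a CM field)
and a rational class `h` with a Kähler multiple for which `φ^*` is a `d`-similitude: `A` is NOT divisor-generated — the Weil plane
meets `D³ ⊗ ℂ` trivially (Moonen–Zarhin 1998 Criterion (2) at `u = φ`). The binder `WeilSixfolds` ∕ Markman₆ of the rows' HC readings
is load-bearing. HC NOT proved; nothing about algebraicity. [cite: MoonenZarhin1998WeilClasses, §1 Criterion (2)]
[cite: vanGeemen1994HodgeAV, Thm. 6.12] [cite: Milne1999LefschetzClasses, §1 p. 642] -/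
theorem not_isDivisorGenerated_weilRow_of_forall_mem_adjoin (hW : IsWeilType A φ 3 d) (φE : A ⟶ A)
    (hgen : ∀ ψ : A ⟶ A, pullbackOne A ψ ∈ Algebra.adjoin ℂ {pullbackOne A φE})
    (hQ : IsRationalClass h) (hK : ∃ s : ℝ, 0 < s ∧ IsKaehlerClass A.dim A.X ((s : ℂ) • h))
    (hφQ : ∀ x y, polarizationPairingOne A.X h (A.dim - 1) (pullbackOne A φ x) (pullbackOne A φ y) =
      (d : ℂ) • polarizationPairingOne A.X h (A.dim - 1) x y) :
    ¬ IsDivisorGenerated A :=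
  hW.not_isDivisorGenerated_of_forall_mem_adjoin hgen hQ (polClass_of_kaehler hK).1 (polClass_of_kaehler hK).2 hφQ

/-- **ROW 9 (`End⁰ = K` EXACTLY), EVERY MEMBER: `B(A) ≠ D(A)`** — `finrank_ℚ End⁰(A) = 2` makes every pull-back a polynomial in
`φ^*` (`pullbackOne_mem_adjoin_of_finrank_endAlgebra_eq_two`), so the previous theorem applies with `φ_E = φ`. Van Geemen 6.12 for
the GENERAL member (`B³ = D³ ⊕ W_K`); here `W_K ⊄ D³` for EVERY member. HC NOT proved; nothing about algebraicity.
[cite: vanGeemen1994HodgeAV, Thm. 6.11 and Thm. 6.12] [cite: MoonenZarhin1998WeilClasses, §1 Criterion (2)] -/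
theorem not_isDivisorGenerated_row9_endK (hW : IsWeilType A φ 3 d) (hE2 : Module.finrank ℚ A.endAlgebra = 2)
    (hQ : IsRationalClass h) (hK : ∃ s : ℝ, 0 < s ∧ IsKaehlerClass A.dim A.X ((s : ℂ) • h))
    (hφQ : ∀ x y, polarizationPairingOne A.X h (A.dim - 1) (pullbackOne A φ x) (pullbackOne A φ y) =
      (d : ℂ) • polarizationPairingOne A.X h (A.dim - 1) x y) :
    ¬ IsDivisorGenerated A :=
  not_isDivisorGenerated_weilRow_of_forall_mem_adjoin hW φ
    (pullbackOne_mem_adjoin_of_finrank_endAlgebra_eq_two hW.d_pos hW.sq_eq hE2 (by rw [hW.dim_eq]; norm_num)) hQ hK hφQ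

/-- `(φ ≫ ψ)^* = φ^* ∘ ψ^*` on `H¹` (contravariance). [folklore] -/
private theorem pullbackOne_comp'' (φ ψ : A ⟶ A) : pullbackOne A (φ ≫ ψ) = pullbackOne A φ * pullbackOne A ψ := by
  change (complexBetti.map (φ.hom.hom.hom ≫ ψ.hom.hom.hom) 1).hom = _
  rw [complexBetti.map_comp, ModuleCat.hom_comp]
  rfl

/-- **ROW 19 (`A ∼ Y₃ × Y₃′`), EVERY MEMBER, in L17's vocabulary: `B(A) ≠ D(A)`** — Milne's datum `hC : C(A) ⊗ ℂ = Z(φ_E^*)`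
(`End⁰(A) = K × K = ℚ[φ_E]`) and `φ ≫ φ_E = φ_E ≫ φ` put `φ^*` in `C(A) ⊗ ℂ`; then `IsWeilType.not_isDivisorGenerated_of_mem_centralizerAlgebra`.
HC NOT proved; nothing about algebraicity. [cite: MoonenZarhin1998WeilClasses, §1 Criterion (2)] [cite: MoonenZarhin1999LowDim, §5 (5.11)]
[cite: Milne1999LefschetzClasses, §1 p. 642] -/
theorem not_isDivisorGenerated_row19_of_centralizer (hW : IsWeilType A φ 3 d) (φE : A ⟶ A)
    (hC : centralizerAlgebra A = Subalgebra.centralizer ℂ {pullbackOne A φE}) (hφE : φ ≫ φE = φE ≫ φ)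
    (hQ : IsRationalClass h) (hK : ∃ s : ℝ, 0 < s ∧ IsKaehlerClass A.dim A.X ((s : ℂ) • h))
    (hφQ : ∀ x y, polarizationPairingOne A.X h (A.dim - 1) (pullbackOne A φ x) (pullbackOne A φ y) =
      (d : ℂ) • polarizationPairingOne A.X h (A.dim - 1) x y) :
    ¬ IsDivisorGenerated A := by
  have huC : pullbackOne A φ ∈ centralizerAlgebra A := by
    rw [hC, Subalgebra.mem_centralizer_iff]
    rintro _ rfl
    rw [← pullbackOne_comp'', ← pullbackOne_comp'', hφE]
  exact hW.not_isDivisorGenerated_of_mem_centralizerAlgebra huC hQ (polClass_of_kaehler hK).1 (polClass_of_kaehler hK).2 hφQ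

end Summit.HodgeConjecture.HodgeConjecture.TableX.WeilLieRows

end
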